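import Summits.PneNP.PneNP.Theorems.KarlinRubinMonotoneBlindCoverCompleteness
import Summits.PneNP.PneNP.Theorems.KarlinRubinMonotoneBlindDnfBlind

/-!
# Crux `MonotoneBlind` (stmt-PneNP-18027, route KarlinRubin), line `Sketch`: the cover certificate for quiet polynomial-term DNFs

First INSTANCE of the hard stub `stub_coverCertificate` of line `Sketch` for a class of tests: by the
completeness engine `coverCertificate_of_plantedAcceptance_tendsto_zero`
(`KarlinRubinMonotoneBlindCoverCompleteness.lean`, Park–Pham at the larger clique) every
strong-blindness theorem yields cheap covers; fed with the landed depth-2 theorem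
`Summit.PneNP.PneNP.Theorems.karlinRubin_dnf_planted_tendsto_zero` (quiet monotone DNFs with
`≤ n^c` terms have vanishing planted acceptance at every exponent) it gives:

* `coverCertificate_dnf` — for `0 < δ < 1/2`, `c : ℕ`, term families `𝓔 n` with `#(𝓔 n) ≤ n^c`
  eventually and null acceptance `→ 0`, and every `η > 0`: the `G(n,1/2)`-probability of the noises
  `x` at which the clique-completion up-set `{A | ∃ E ∈ 𝓔 n, E ⊆ x ∪ K_A}` has NO cover of
  `(⌈n^{1/2-δ}⌉/n)`-cost `≤ η` tends to `0`.

So the dual certificate exists for depth 2 with the same room as the crux (poly versus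
`n^{Θ(log n)}` terms); note the certificate is produced non-constructively (Park–Pham), whereas the
explicit cover by sunflower CORES of the dark terms is what a gate-by-gate calculus would build.

All `--supports stmt-PneNP-18027`; no definitions.
-/

set_option linter.dupNamespace false -- `Summit.PneNP.PneNP.…` is the layout-mandated namespace

namespace Summit.PneNP.PneNP.Theorems.MonotoneBlind.VertexCover

open Literature.Computability.Complexity Literature.Probability.RandomGraphs.PlantedClique Filter Finset
open scoped ENNReal Topology Classical

/-- **The cover certificate for quiet polynomial-term monotone DNFs.** For `0 < δ < 1/2` and `c`, if
`#(𝓔 n) ≤ n^c` eventually and `Pr_{G(n,1/2)}[∃ E ∈ 𝓔 n, E ⊆ x] → 0`, then for every `η > 0` the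
probability that the up-set `{A | ∃ E ∈ 𝓔 n, E ⊆ plant A x}` has no cover `G` with
`∑_{S ∈ G} (d/n)^{|S|} ≤ η`, `d = min ⌈n^{1/2-δ}⌉ n`, tends to `0`. Proof: the DNF test
`x ↦ [∃ E ∈ 𝓔 n, E ⊆ x]` is monotone and strongly blind at `δ/2`
(`karlinRubin_dnf_planted_tendsto_zero`); apply
`coverCertificate_of_plantedAcceptance_tendsto_zero`. [folklore] -/
theorem coverCertificate_dnf :
    ∀ δ : ℝ, 0 < δ → δ < 1 / 2 → ∀ c : ℕ,
      ∀ 𝓔 : (n : ℕ) → Finset (Finset (⊤ : SimpleGraph (Fin n)).edgeSet),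
      (∀ᶠ n : ℕ in atTop, #(𝓔 n) ≤ n ^ c) →
      Tendsto (fun n : ℕ =>
        (erdosRenyiHalf n).toOuterMeasure {x | ∃ E ∈ 𝓔 n, ∀ e ∈ E, x e = true}) atTop (𝓝 0) →
      ∀ η : ℝ≥0∞, 0 < η →
        Tendsto (fun n : ℕ => (erdosRenyiHalf n).toOuterMeasure
          {x | ¬ ∃ G : Finset (Finset (Fin n)),
            (∀ A : Finset (Fin n), (∃ E ∈ 𝓔 n, ∀ e ∈ E, plant A x e = true) → ∃ S ∈ G, S ⊆ A) ∧
              ∑ S ∈ G, ((((min ⌈(n : ℝ) ^ (1 / 2 - δ)⌉₊ n : ℕ) : ℝ≥0∞) / (n : ℝ≥0∞)) ^ S.card) ≤ η})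
          atTop (𝓝 0) := by
  intro δ hδ hδ' c 𝓔 hM hquiet η hη
  -- the DNF test as a Boolean function
  set f : (n : ℕ) → EdgeVec n → Bool := fun n x => decide (∃ E ∈ 𝓔 n, ∀ e ∈ E, x e = true) with hf
  have hset : ∀ n : ℕ, {y : EdgeVec n | f n y = true} = {x | ∃ E ∈ 𝓔 n, ∀ e ∈ E, x e = true} := by
    intro n
    ext y
    simp only [hf, Set.mem_setOf_eq, decide_eq_true_eq]
  have hmono : ∀ᶠ n : ℕ in atTop, Monotone (f n) := by
    refine Eventually.of_forall fun n x y hxy => ?_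
    simp only [hf]
    rw [Bool.le_iff_imp, decide_eq_true_eq, decide_eq_true_eq]
    rintro ⟨E, hE, hEx⟩
    refine ⟨E, hE, fun e he => ?_⟩
    have h := hxy e
    rw [hEx e he] at h
    exact top_le_iff.1 h
  -- strong blindness of the DNF at `δ/2`
  have hP : Tendsto (fun n : ℕ => (plantedCliqueDist n ⌈(n : ℝ) ^ (1 / 2 - δ / 2)⌉₊).toOuterMeasure
      {y | f n y = true}) atTop (𝓝 0) := by
    simp only [hset]
    exact Summit.PneNP.PneNP.Theorems.karlinRubin_dnf_planted_tendsto_zero (by linarith) (by linarith) c 𝓔 hM hquiet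
  have h := coverCertificate_of_plantedAcceptance_tendsto_zero f hmono (by linarith : 0 < δ / 2)
    (by linarith : δ / 2 < δ) hδ' hP η hη
  refine h.congr' (Eventually.of_forall fun n => ?_)
  simp only [hf, decide_eq_true_eq]

end Summit.PneNP.PneNP.Theorems.MonotoneBlind.VertexCover
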